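import Mathlib
import Summits.Ventures.HodgeRepro2.BridgeCore

/-!
# BridgeWeilLine — the split Weil line is a simple module over the correspondence algebra (Tier 4)

Seat p4 of the blind cell pub-hodge-repro2 (README §6, T4-A). `BridgeCore` proves the bridge for any
simple `R`-submodule `weil`; this file shows that the split Weil line really is one: as an abstract
module, `W_𝐅(B) = ⋀⁴_𝐅 H¹(B,ℚ) = H¹(A₁) ⊗_𝐅 H¹(A₂) ⊗_𝐅 H¹(A₃) ⊗_𝐅 H¹(A₄) ≅ 𝐅` (each `H¹(A_i,ℚ)` is a free
`𝐅`-module of rank one), on which the correspondence algebra `𝐅 ⊗_ℚ 𝐅 ⊗_ℚ 𝐅 ⊗_ℚ 𝐅` (the four `𝐅`-actions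
`f₁ ⊗ f₂ ⊗ f₃ ⊗ f₄ ↦ (f₁, f₂, f₃, f₄)^*`) acts through the multiplication map
`f₁ ⊗ f₂ ⊗ f₃ ⊗ f₄ ↦ f₁ f₂ f₃ f₄`, which is surjective. Kernel-checked:

* `isSimpleModule_of_surjective`: a field on which a commutative ring acts through a surjective ring
  map is a simple module (special case of `BridgeCore.isSimpleModule_of_surjective_of_finrank_eq_one`);
* `mulMap`, `mulMap_tmul`, `mulMap_surjective`: the multiplication map of the four-fold tensor product;
* `isSimpleModule_weilLine`: `𝐅` is a simple `𝐅 ⊗ 𝐅 ⊗ 𝐅 ⊗ 𝐅`-module — the hypothesis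
  `[IsSimpleModule R D.weil]` of `BridgeData.weil_le_alg_of_pair_ne_zero` for the split Weil line.
-/

namespace Summit.Ventures.HodgeRepro2.BridgeWeilLine

open Summit.Ventures.HodgeRepro2.BridgeCore TensorProduct

section General

variable {R F : Type*} [CommRing R] [Field F]

/-- A field `F` on which a commutative ring `R` acts through a surjective ring map `χ : R → F` is a
simple `R`-module. -/
theorem isSimpleModule_of_surjective (χ : R →+* F) (hχ : Function.Surjective χ) :
    letI := χ.toAlgebra; IsSimpleModule R F := by
  letI := χ.toAlgebra
  have hsurj : Function.Surjective (algebraMap R F) := by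
    rw [RingHom.algebraMap_toAlgebra]
    exact hχ
  exact isSimpleModule_of_surjective_of_finrank_eq_one hsurj (Module.finrank_self F)

end General

section CorrAlg

variable (F : Type*) [Field F] [Algebra ℚ F]

/-- The correspondence algebra `𝐅 ⊗_ℚ 𝐅 ⊗_ℚ 𝐅 ⊗_ℚ 𝐅` of the corner product `B = ∏ᵢ₌₁⁴ A_{Tᵢ}`: the
pure tensor `f₁ ⊗ f₂ ⊗ f₃ ⊗ f₄` is the endomorphism `(f₁, f₂, f₃, f₄)` of `B`. -/
abbrev CorrAlg : Type _ := (F ⊗[ℚ] F) ⊗[ℚ] (F ⊗[ℚ] F)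

/-- The multiplication map `𝐅 ⊗ 𝐅 ⊗ 𝐅 ⊗ 𝐅 → 𝐅`, `f₁ ⊗ f₂ ⊗ f₃ ⊗ f₄ ↦ f₁ f₂ f₃ f₄`: the action of the
correspondence algebra on the split Weil line `⋀⁴_𝐅 H¹ ≅ 𝐅`. -/
noncomputable def mulMap : CorrAlg F →ₐ[ℚ] F :=
  (Algebra.TensorProduct.lmul' ℚ).comp
    (Algebra.TensorProduct.map (Algebra.TensorProduct.lmul' ℚ) (Algebra.TensorProduct.lmul' ℚ))

/-- `mulMap` on pure tensors. -/
theorem mulMap_tmul (a b c d : F) :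
    mulMap F ((a ⊗ₜ[ℚ] b) ⊗ₜ[ℚ] (c ⊗ₜ[ℚ] d)) = a * b * (c * d) := by
  simp [mulMap]

/-- The multiplication map is surjective (`x = mulMap (x ⊗ 1 ⊗ 1 ⊗ 1)`). -/
theorem mulMap_surjective : Function.Surjective (mulMap F) := fun x =>
  ⟨(x ⊗ₜ[ℚ] (1 : F)) ⊗ₜ[ℚ] ((1 : F) ⊗ₜ[ℚ] (1 : F)), by rw [mulMap_tmul]; ring⟩

/-- **The split Weil line is a simple module over the correspondence algebra.** `𝐅`, as a module over
`𝐅 ⊗_ℚ 𝐅 ⊗_ℚ 𝐅 ⊗_ℚ 𝐅` through the multiplication map, is simple — the hypothesis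
`[IsSimpleModule R D.weil]` of the bridge theorem, discharged for `W_𝐅(B) ≅ 𝐅`. -/
theorem isSimpleModule_weilLine :
    letI := (mulMap F).toRingHom.toAlgebra; IsSimpleModule (CorrAlg F) F :=
  isSimpleModule_of_surjective (mulMap F).toRingHom (mulMap_surjective F)

end CorrAlg

end Summit.Ventures.HodgeRepro2.BridgeWeilLine
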